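import Summits.Ventures.PercRepro.C025ProfileGirthDualAll

/-!
# THE THIN HALF OF EVERY ROW AT GIRTH `≥ q+1` (night-3 g20)

For every `j` the thin rank-`q` sets (the `q`-subsets) satisfy `Σ_{B ∈ Rq, #B = q} price_{q, q+j}(B) ≤ #{independent
(q+j)-sets}` (`thinIneq_all`), by the double count `Σ_B #{independent (q+j)-subsets of E ∖ B} = C(n − q − j, q) ·
#{independent (q+j)-sets}` (`sum_card_indep_sdiff_eq_all`) and the dual inequality `dual_count_all` of the companion
module with `C(p+q, q+j)/C(p+q, q) = C(p, j)/C(q+j, j)`.  No `def`, no `instance`, no notation.  Axioms: standard.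
-/

open scoped Matroid

namespace PercRepro

open Set Finset ThmH Staged

namespace GirthRows

variable {α : Type} [DecidableEq α]

variable {M : Matroid α} [M.Finite]

open scoped Classical in
/-- The double count at level `q + j`: `Σ_{B ∈ C(E, q)} #{U ∈ C(E ∖ B, q+j) : U independent} = C(n − q − j, q) · #{U ∈ C(E, q+j) :
U independent}`. -/
theorem sum_card_indep_sdiff_eq_all (q j : ℕ) :
    ∑ B ∈ (gr M).powersetCard q,
        (((gr M \ B).powersetCard (q + j)).filter (fun U : Finset α => M.Indep (U : Set α))).card =
      ((gr M).card - q - j).choose q *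
        (((gr M).powersetCard (q + j)).filter (fun U : Finset α => M.Indep (U : Set α))).card := by
  have h1 : ∀ B ∈ (gr M).powersetCard q,
      (((gr M \ B).powersetCard (q + j)).filter (fun U : Finset α => M.Indep (U : Set α))).card =
        ∑ U ∈ ((gr M).powersetCard (q + j)).filter (fun U : Finset α => M.Indep (U : Set α)),
          (if Disjoint U B then 1 else 0) := by
    intro B _
    rw [Finset.sum_boole]
    simp only [Nat.cast_id]
    congr 1
    ext U
    simp only [Finset.mem_filter, Finset.mem_powersetCard]
    constructor
    · rintro ⟨⟨hUg, hUc⟩, hUi⟩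
      refine ⟨⟨⟨hUg.trans Finset.sdiff_subset, hUc⟩, hUi⟩, ?_⟩
      rw [Finset.disjoint_left]
      intro x hxU hxB
      exact (Finset.mem_sdiff.1 (hUg hxU)).2 hxB
    · rintro ⟨⟨⟨hUg, hUc⟩, hUi⟩, hd⟩
      refine ⟨⟨?_, hUc⟩, hUi⟩
      intro x hx
      rw [Finset.mem_sdiff]
      exact ⟨hUg hx, Finset.disjoint_left.1 hd hx⟩
  rw [Finset.sum_congr rfl h1, Finset.sum_comm]
  have h2 : ∀ U ∈ ((gr M).powersetCard (q + j)).filter (fun U : Finset α => M.Indep (U : Set α)),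
      ∑ B ∈ (gr M).powersetCard q, (if Disjoint U B then 1 else 0) = ((gr M).card - q - j).choose q := by
    intro U hU
    rw [Finset.mem_filter, Finset.mem_powersetCard] at hU
    rw [Finset.sum_boole]
    simp only [Nat.cast_id]
    have : ((gr M).powersetCard q).filter (fun B => Disjoint U B) = (gr M \ U).powersetCard q := by
      ext B
      simp only [Finset.mem_filter, Finset.mem_powersetCard]
      constructor
      · rintro ⟨⟨hBg, hBc⟩, hd⟩
        refine ⟨?_, hBc⟩
        intro x hx
        rw [Finset.mem_sdiff]
        exact ⟨hBg hx, fun hxU => Finset.disjoint_left.1 hd hxU hx⟩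
      · rintro ⟨hBg, hBc⟩
        refine ⟨⟨hBg.trans Finset.sdiff_subset, hBc⟩, ?_⟩
        rw [Finset.disjoint_left]
        intro x hxU hxB
        exact (Finset.mem_sdiff.1 (hBg hxB)).2 hxU
    rw [this, Finset.card_powersetCard, Finset.card_sdiff_of_subset hU.1.1, hU.1.2]
    congr 1
    omega
  rw [Finset.sum_congr rfl h2, Finset.sum_const, smul_eq_mul, mul_comm]

open scoped Classical in
/-- **THE THIN HALF OF EVERY ROW**: at girth `≥ q + 1`, for every `j ≥ 1`,
`Σ_{B ∈ Rq, #B = q} price_{q,q+j}(B) ≤ #{independent (q+j)-sets}`. -/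
theorem thinIneq_all {q j : ℕ} (hg : ∀ T ⊆ M.E, T.encard ≤ q → M.Indep T) :
    ∑ B ∈ (Profile.Rq M q).filter (fun B : Finset α => B.card = q), Profile.price M q (q + j) B ≤
      ((((gr M).powersetCard (q + j)).filter (fun U : Finset α => M.Indep (U : Set α))).card : ℚ) := by
  -- (DUAL_B) for every `q`-subset
  have hdual : ∀ B ∈ (gr M).powersetCard q,
      Profile.price M q (q + j) B * (((gr M).card - q - j).choose q : ℚ) ≤
        ((((gr M \ B).powersetCard (q + j)).filter (fun U : Finset α => M.Indep (U : Set α))).card : ℚ) := by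
    intro B hB
    rw [Finset.mem_powersetCard] at hB
    obtain ⟨hBg, hBc⟩ := hB
    set A := gr M \ B with hA
    have hAg : A ⊆ gr M := Finset.sdiff_subset
    have hsd : A.card = (gr M).card - q := by rw [hA, Finset.card_sdiff_of_subset hBg, hBc]
    unfold Profile.price
    split_ifs with hthr
    · set p := rkN M A with hp
      have hpdef : (M.eRk (A : Set α)).toNat = p := rfl
      rw [hpdef]
      have hpq : q + j ≤ p := by
        have h := hthr
        rw [← Staged.coe_rkN] at h
        exact_mod_cast h
      have hple : ((p : ℕ) : ℕ∞) ≤ M.eRk (A : Set α) := by rw [← Staged.coe_rkN]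
      have hdc := dual_count_all j q M A hAg hg p hple hpq
      have hAc : A.card - j = (gr M).card - q - j := by omega
      rw [hAc] at hdc
      have hid := choose_add_mul_choose_eq p q j
      have hpos1 : (0 : ℚ) < ((p + q).choose q : ℕ) := by exact_mod_cast Nat.choose_pos (by omega)
      have hpos2 : (0 : ℚ) < ((q + j).choose j : ℕ) := by exact_mod_cast Nat.choose_pos (by omega)
      rw [div_mul_eq_mul_div, div_le_iff₀ hpos1]
      have hdcQ : ((p.choose j : ℕ) : ℚ) * (((gr M).card - q - j).choose q : ℕ) ≤
          (((q + j).choose j : ℕ) : ℚ) *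
            ((((gr M \ B).powersetCard (q + j)).filter (fun U : Finset α => M.Indep (U : Set α))).card : ℚ) := by
        exact_mod_cast hdc
      have hidQ : (((p + q).choose (q + j) : ℕ) : ℚ) * ((q + j).choose j : ℕ) =
          (((p + q).choose q : ℕ) : ℚ) * (p.choose j : ℕ) := by exact_mod_cast hid
      apply le_of_mul_le_mul_right _ hpos2
      calc (((p + q).choose (q + j) : ℕ) : ℚ) * (((gr M).card - q - j).choose q : ℕ) * ((q + j).choose j : ℕ)
          = (((p + q).choose q : ℕ) : ℚ) * ((p.choose j : ℕ) * (((gr M).card - q - j).choose q : ℕ)) := by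
            rw [mul_right_comm, hidQ]; ring
        _ ≤ (((p + q).choose q : ℕ) : ℚ) * (((q + j).choose j : ℕ) *
            ((((gr M \ B).powersetCard (q + j)).filter (fun U : Finset α => M.Indep (U : Set α))).card : ℚ)) :=
            mul_le_mul_of_nonneg_left hdcQ hpos1.le
        _ = _ := by ring
    · rw [zero_mul]
      exact Nat.cast_nonneg _
  -- the thin members of `Rq` are `q`-subsets
  have hsub : (Profile.Rq M q).filter (fun B : Finset α => B.card = q) ⊆ (gr M).powersetCard q := by
    intro B hB
    rw [Finset.mem_filter, Profile.mem_Rq] at hB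
    rw [Finset.mem_powersetCard]
    exact ⟨hB.1.1, hB.2⟩
  have h0 : ∑ B ∈ (Profile.Rq M q).filter (fun B : Finset α => B.card = q), Profile.price M q (q + j) B ≤
      ∑ B ∈ (gr M).powersetCard q, Profile.price M q (q + j) B :=
    Finset.sum_le_sum_of_subset_of_nonneg hsub (fun B _ _ => Profile.price_nonneg _ _ _)
  by_cases hC : ((gr M).card - q - j).choose q = 0
  · have hz : ∀ B ∈ (gr M).powersetCard q, Profile.price M q (q + j) B = 0 := by
      intro B hB
      rw [Finset.mem_powersetCard] at hB
      have hlt : (gr M).card - q - j < q := Nat.choose_eq_zero_iff.1 hC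
      unfold Profile.price
      rw [if_neg]
      intro hthr
      have h1 : ((q + j : ℕ) : ℕ∞) ≤ ((gr M \ B).card : ℕ∞) := by
        refine hthr.trans ?_
        rw [← Set.encard_coe_eq_coe_finsetCard]
        exact M.eRk_le_encard _
      have h2 : q + j ≤ (gr M \ B).card := by exact_mod_cast h1
      rw [Finset.card_sdiff_of_subset hB.1, hB.2] at h2
      omega
    calc ∑ B ∈ (Profile.Rq M q).filter (fun B : Finset α => B.card = q), Profile.price M q (q + j) B
        ≤ ∑ B ∈ (gr M).powersetCard q, Profile.price M q (q + j) B := h0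
      _ = 0 := Finset.sum_eq_zero hz
      _ ≤ _ := Nat.cast_nonneg _
  · have hCpos : (0 : ℚ) < (((gr M).card - q - j).choose q : ℕ) := by
      exact_mod_cast Nat.pos_of_ne_zero hC
    have h3 : ∑ B ∈ (gr M).powersetCard q, Profile.price M q (q + j) B ≤
        ∑ B ∈ (gr M).powersetCard q,
          ((((gr M \ B).powersetCard (q + j)).filter (fun U : Finset α => M.Indep (U : Set α))).card : ℚ) /
            (((gr M).card - q - j).choose q : ℚ) := by
      apply Finset.sum_le_sum
      intro B hB
      rw [le_div_iff₀ hCpos]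
      exact hdual B hB
    have h4 : ∑ B ∈ (gr M).powersetCard q,
          ((((gr M \ B).powersetCard (q + j)).filter (fun U : Finset α => M.Indep (U : Set α))).card : ℚ) /
            (((gr M).card - q - j).choose q : ℚ) =
        ((((gr M).powersetCard (q + j)).filter (fun U : Finset α => M.Indep (U : Set α))).card : ℚ) := by
      rw [← Finset.sum_div, div_eq_iff hCpos.ne']
      have := sum_card_indep_sdiff_eq_all (M := M) q j
      have h' : ((∑ B ∈ (gr M).powersetCard q,
          (((gr M \ B).powersetCard (q + j)).filter (fun U : Finset α => M.Indep (U : Set α))).card : ℕ) : ℚ) =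
          ((((gr M).card - q - j).choose q *
            (((gr M).powersetCard (q + j)).filter (fun U : Finset α => M.Indep (U : Set α))).card : ℕ) : ℚ) := by
        rw [this]
      push_cast at h'
      rw [h']
      ring
    calc ∑ B ∈ (Profile.Rq M q).filter (fun B : Finset α => B.card = q), Profile.price M q (q + j) B
        ≤ ∑ B ∈ (gr M).powersetCard q, Profile.price M q (q + j) B := h0
      _ ≤ _ := h3
      _ = _ := h4

end GirthRows

end PercRepro
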